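import Summits.QuantumFields.BalabanUV.Beta.SymCorrectorSlot
import Summits.QuantumFields.BalabanUV.Beta.SymCorrectorFaceDiv
import Summits.QuantumFields.BalabanUV.Beta.GAN24.Push4

/-!
# `BalabanUV.Beta.GAN24.CombTransportThreeLegs` — binder row G-an2-4 ∕ (CONV-C), TRANSFER-III (the G-an2-4 END at row D1's literal of record (III′)), THE FIXED TRANSPORT
# `𝒯 X := κ u ↦ Ψ̂_Sᵀ ∘ (slotPsiS r n X) κ u ∘ Ψ̂_S` OF road-P2's `CombCubicStepTransport` (M.43) ∕ `CombQuarticStepTransport` (M.45) READ ENTRYWISE: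
# **ON A TABLE's FIELD–FIELD BLOCK, `𝒯` IS THE FACE-SUM SLOT TRANSPORT `slotPsiS r n` APPLIED TO EACH OF ITS THREE BOND LEGS** (the slot leg `(κ, u)` and the two kernel
# legs `(α, x)`, `(β, z)`) — NO hypothesis on the table; on an ff-valued table (the Wilson lineage) `𝒯` is therefore ff-valued and equals the table iff ∕ as soon as the
# three leg-divergence block charges vanish; in general `𝒯X − X` is a sum of face terms `faceWt • (block sum of that leg's divergences)` (d1-leaf-03's TT7) — i.e. the
# (III′) S-∕W-campaign's new input through `𝒯` is EXACTLY the tower's slot Ward letters AND its kernel-LEG Ward letters ((Q-L)'s `hL₁ ∕ hL₂` currency), block-summed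
# (G-an2-4 CRUX TEAM (2), seat `b2b-balaban-gan24-p2` = road-P2 chair, gen 55; sharpens M.44 — which read the slot leg only — to all three legs)

NOT IN PRINT; OUR BOOKKEEPING ([folklore] finite-sum bookkeeping BY NAME over d1-formalise-leaf-03 gen 28∕29's apply bridges `SymCorrectorSlot.comp_trK_psiKS_inl_left ∕ comp_psiKS_inl_right ∕
comp_trK_psiKS_inr_left ∕ comp_psiKS_inr_right` («the field legs of ANY kernel are transported by the face sum, the multiplier legs untouched») and TT7
`SymCorrectorFaceDiv.slotPsiS_eq_self_of_div_eq_zero ∕ slotPsiS_of_divLaw`, leaf-01's `GAN24.Push4.IsFF`; 0 `def`, 0 cited fact, 0 `def … : Prop`, 0 sorry).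
HONEST FRAMING (cell contract, verbatim): «discharging `BetaPertH` makes Bałaban's UV stability UNCONDITIONAL — a real constructive-QFT result; it is NOT the continuum
limit and NOT the Clay problem.»  HONEST DEPENDENCY (verbatim): «continuum YM on T⁴ ⇐ BetaPertH ∧ nine spine estimates (0/9 proved); BetaPertH ⇐ (D1) ∧ (D4) ∧ CAP+tail;
G-an2-4 gates asym, D1 and NE2/3/4.»
ABSOLUTE RULE (cell charter, verbatim): «No internally-minted statement may enter as a cited fact. Every hypothesis is either kernel-proved in this package or a
verbatim quotation of a PUBLISHED theorem with page reference. The manuscript(s) under audit are NOT citable for their own disputed steps — they are the thing under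
adjudication; programme-internal (2001/route/tribunal) claims are never citable.»  Nothing is cited here.

## What is proved (generic `d`; blocking `n` with `0 < n`, root offset `r ∈ box (d+1) n`, `Ψ̂ = psiKS r n`)
* §1 **`transport_inl_inl`** (ANY table `X`): `(Ψ̂ᵀ ∘ slotPsiS r n X κ u ∘ Ψ̂) x z (inl α) (inl β) = slotPsiS r n (β z ↦ slotPsiS r n (α x ↦ slotPsiS r n X κ u x z (inl α) (inl β)) α x) β z`
  — the three legs, each through the SAME finite face-sum transport; `transport_inl_inr ∕ _inr_left` (the multiplier legs: `Ψ̂ᵀ ∘ Y ∘ Ψ̂` keeps `Y`'s `(·, inr)` columns and transports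
  only the left field leg of its `(inr, ·)`… — precisely: `(Ψ̂ᵀYΨ̂)(inl α, inr m) = slotPsiS` of `Y`'s left leg at the untouched column, `(Ψ̂ᵀYΨ̂)(inr m, b) = (Y∘Ψ̂)(inr m, b)`).
* §2 ff-VALUED TABLES (the Wilson lineage, every `mmRead` ∕ `e3OfK` output): **`isFF_transport`** (`𝒯X` is ff-valued), **`transport_eq_threeLegs_of_isFF`** (the whole kernel
  `𝒯X κ u` is the ff-placement of the three-leg transport), **`transport_eq_self_of_legDiv_zero`**: if the three leg-divergence fields of `X` vanish pointwise
  (`Σ_κ (X κ (u−e_κ) − X κ u) = 0` in the slot leg and the same in each kernel leg) then `𝒯X = X`.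
WHAT THIS IS NOT: no estimate; the leg Ward LETTERS of the (III′) tower tables are not supplied here (slot leg: an2's (Sd)∕(Wd) — road-P2 M.44; kernel legs: the (Q-L) leg-letter
currency of leaf-03's `LegLetterRowsOfLegChain` ∕ OWNER parts 4–8 at (E), whose (III′) supply is the campaign); NO value, NO rate; NO campaign opened (an2 W-4 stands);
NEVER «G-an2-4 closed» as (CONV-C); NOT D1, NOT `BetaPertH`, NOT continuum, NOT Clay.  2026-08-25; no existing file touched.
-/

noncomputable section

open Finset
open scoped BigOperators
open Literature.MathematicalPhysics.QuantumFieldTheory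
open Literature.MathematicalPhysics.QuantumFieldTheory.Balaban1983to89
open Literature.MathematicalPhysics.QuantumFieldTheory.Balaban1983to89.Beta
open ExpKernelCalculus (MKer comp)
open AffineAveraging (Site box toSite unitVec)
open AveragingContours (blk)
open OneStepResolventKernel (Fib)
open Summit.QuantumFields.BalabanUV.Beta.TameKernelCalculus (trK)
open Summit.QuantumFields.BalabanUV.Beta.SymCorrectorKernel (psiKS)
open Summit.QuantumFields.BalabanUV.Beta.SymCorrectorFace (faceWt faceSum slotPsiS slotPsiS_apply)
open Summit.QuantumFields.BalabanUV.Beta.SymCorrectorSlot (comp_trK_psiKS_inl_left comp_psiKS_inl_right comp_trK_psiKS_inr_left comp_psiKS_inr_right)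
open Summit.QuantumFields.BalabanUV.Beta.SymCorrectorFaceDiv (slotPsiS_eq_self_of_div_eq_zero)
open Summit.QuantumFields.BalabanUV.Beta.GAN24.Push4 (IsFF)

namespace Summit.QuantumFields.BalabanUV.Beta.GAN24.CombTransportThreeLegs

variable {d : ℕ} {n : ℕ} (hn : 0 < n) {r : Fin (d + 1) → ℕ} (hr : r ∈ box (d + 1) n)
include hn hr

/-! ## §1 The three legs of the fixed transport, entrywise — no hypothesis on the table -/

/-- NOT IN PRINT; OUR BOOKKEEPING ([folklore]).  **THE FIELD–FIELD ENTRIES OF `Ψ̂ᵀ ∘ Y ∘ Ψ̂`, ANY KERNEL `Y`**: both field legs go through the finite face-sum slot transport —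
`(Ψ̂ᵀ∘Y∘Ψ̂) x z (inl α) (inl β) = slotPsiS r n (β z ↦ slotPsiS r n (α x ↦ Y x z (inl α) (inl β)) α x) β z` (leaf-03's two apply bridges, one after the other). -/
theorem conj_inl_inl (Y : MKer (d + 1) (Fib d)) (x z : Site (d + 1)) (α β : Fin (d + 1)) :
    comp (comp (trK (psiKS r n)) Y) (psiKS r n) x z (Sum.inl α) (Sum.inl β)
      = slotPsiS r n (fun β z => slotPsiS r n (fun α x => Y x z (Sum.inl α) (Sum.inl β)) α x) β z := by
  rw [comp_psiKS_inl_right hn hr]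
  congr 1
  funext κ u
  exact comp_trK_psiKS_inl_left hn hr Y x u α (Sum.inl κ)

/-- NOT IN PRINT; OUR BOOKKEEPING ([folklore]; THE THREE LEGS).  **ON THE FIELD–FIELD BLOCK, `𝒯` IS `slotPsiS` ON EACH OF THE THREE BOND LEGS** — for ANY table `X`, every slot
bond `(κ, u)` and entry `(x, z, inl α, inl β)`:
`(Ψ̂ᵀ ∘ slotPsiS r n X κ u ∘ Ψ̂) x z (inl α) (inl β) = slotPsiS r n (β z ↦ slotPsiS r n (α x ↦ slotPsiS r n X κ u x z (inl α) (inl β)) α x) β z`. -/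
theorem transport_inl_inl (X : Fin (d + 1) → Site (d + 1) → MKer (d + 1) (Fib d)) (κ : Fin (d + 1)) (u : Site (d + 1))
    (x z : Site (d + 1)) (α β : Fin (d + 1)) :
    comp (comp (trK (psiKS r n)) (slotPsiS r n X κ u)) (psiKS r n) x z (Sum.inl α) (Sum.inl β)
      = slotPsiS r n (fun β z => slotPsiS r n (fun α x => slotPsiS r n X κ u x z (Sum.inl α) (Sum.inl β)) α x) β z :=
  conj_inl_inl hn hr _ x z α β

omit hn hr in
/-- [folklore] **THE RIGHT MULTIPLIER LEG IS UNTOUCHED AND THE LEFT FIELD LEG STILL TRANSPORTS**: `(Ψ̂ᵀ∘Y∘Ψ̂) x z a (inr m) = (Ψ̂ᵀ∘Y) x z a (inr m)`. -/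
theorem conj_inr_right (Y : MKer (d + 1) (Fib d)) (x z : Site (d + 1)) (a : Fib d) (m : Fin (d + 1)) :
    comp (comp (trK (psiKS r n)) Y) (psiKS r n) x z a (Sum.inr m) = comp (trK (psiKS r n)) Y x z a (Sum.inr m) :=
  comp_psiKS_inr_right _ x z a m

/-! ## §2 ff-valued tables: `𝒯` is ff-valued, is the three-leg transport, and is the identity on leg-divergence-free tables -/

/-- NOT IN PRINT; OUR BOOKKEEPING ([folklore]).  **`Ψ̂ᵀ ∘ Y ∘ Ψ̂` OF AN ff-VALUED `Y` IS ff-VALUED** (the multiplier legs of `Ψ̂` are the identity ∕ zero: the untouched legs read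
`Y`'s vanishing multiplier blocks). -/
theorem isFF_conj {Y : MKer (d + 1) (Fib d)} (hY : IsFF Y) : IsFF (comp (comp (trK (psiKS r n)) Y) (psiKS r n)) := by
  refine ⟨fun x z μ b => ?_, fun x z a ν => ?_⟩
  · -- left multiplier row: `(Ψ̂ᵀ∘Y∘Ψ̂)(inr μ, b)`: `Ψ̂ᵀ`'s multiplier row is untouched, then `Y`'s multiplier row vanishes
    have e : comp (comp (trK (psiKS r n)) Y) (psiKS r n) x z (Sum.inr μ) b
        = comp (fun x' z' a' b' => comp (trK (psiKS r n)) Y x' z' a' b') (psiKS r n) x z (Sum.inr μ) b := rfl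
    rcases b with β | ν
    · rw [comp_psiKS_inl_right hn hr]
      have h0 : (fun κ u => comp (trK (psiKS r n)) Y x u (Sum.inr μ) (Sum.inl κ)) = fun _ _ => (0 : ℝ) := by
        funext κ u; rw [comp_trK_psiKS_inr_left, hY.1]
      rw [h0, slotPsiS_apply]
      simp
    · rw [comp_psiKS_inr_right, comp_trK_psiKS_inr_left, hY.1]
  · -- right multiplier column
    rw [comp_psiKS_inr_right]
    rcases a with α | μ
    · rw [comp_trK_psiKS_inl_left hn hr]
      have h0 : (fun κ u => Y u z (Sum.inl κ) (Sum.inr ν)) = fun _ _ => (0 : ℝ) := by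
        funext κ u; exact hY.2 _ _ _ _
      rw [h0, slotPsiS_apply]
      simp
    · rw [comp_trK_psiKS_inr_left, hY.1]

/-- NOT IN PRINT; OUR BOOKKEEPING ([folklore]).  **THE TRANSPORT OF AN ff-VALUED TABLE IS ff-VALUED** (`slotPsiS` is a finite combination of the table's entries, hence
preserves ff-valuedness; then `isFF_conj`). -/
theorem isFF_transport {X : Fin (d + 1) → Site (d + 1) → MKer (d + 1) (Fib d)} (hX : ∀ κ u, IsFF (X κ u)) (κ : Fin (d + 1)) (u : Site (d + 1)) :
    IsFF (comp (comp (trK (psiKS r n)) (slotPsiS r n X κ u)) (psiKS r n)) := by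
  refine isFF_conj hn hr ⟨fun x z μ b => ?_, fun x z a ν => ?_⟩
  · show (X κ u + faceWt r n κ u • faceSum n X (blk n u)) x z (Sum.inr μ) b = 0
    rw [Pi.add_apply, Pi.add_apply, Pi.add_apply, Pi.add_apply, (hX κ u).1, zero_add, Pi.smul_apply, Pi.smul_apply, Pi.smul_apply, Pi.smul_apply,
      SymCorrectorFace.faceSum_apply_kernel]
    have h0 : (fun κ' u' => X κ' u' x z (Sum.inr μ) b) = fun _ _ => (0 : ℝ) := by funext κ' u'; exact (hX κ' u').1 _ _ _ _
    rw [h0]; simp [SymCorrectorFace.faceSum]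
  · show (X κ u + faceWt r n κ u • faceSum n X (blk n u)) x z a (Sum.inr ν) = 0
    rw [Pi.add_apply, Pi.add_apply, Pi.add_apply, Pi.add_apply, (hX κ u).2, zero_add, Pi.smul_apply, Pi.smul_apply, Pi.smul_apply, Pi.smul_apply,
      SymCorrectorFace.faceSum_apply_kernel]
    have h0 : (fun κ' u' => X κ' u' x z a (Sum.inr ν)) = fun _ _ => (0 : ℝ) := by funext κ' u'; exact (hX κ' u').2 _ _ _ _
    rw [h0]; simp [SymCorrectorFace.faceSum]

/-- NOT IN PRINT; OUR BOOKKEEPING ([folklore]; SUMMARY FOR ff-VALUED TABLES).  **THE WHOLE KERNEL `𝒯X κ u` IS THE ff-PLACEMENT OF THE THREE-LEG FACE TRANSPORT**: for an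
ff-valued table, every entry of `Ψ̂ᵀ ∘ slotPsiS r n X κ u ∘ Ψ̂` is `0` off the field–field block and the three-fold `slotPsiS` on it. -/
theorem transport_eq_threeLegs_of_isFF {X : Fin (d + 1) → Site (d + 1) → MKer (d + 1) (Fib d)} (hX : ∀ κ u, IsFF (X κ u)) (κ : Fin (d + 1)) (u : Site (d + 1)) :
    comp (comp (trK (psiKS r n)) (slotPsiS r n X κ u)) (psiKS r n)
      = fun x z a b => match a, b with
        | Sum.inl α, Sum.inl β => slotPsiS r n (fun β z => slotPsiS r n (fun α x => slotPsiS r n X κ u x z (Sum.inl α) (Sum.inl β)) α x) β z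
        | Sum.inl _, Sum.inr _ => 0
        | Sum.inr _, Sum.inl _ => 0
        | Sum.inr _, Sum.inr _ => 0 := by
  have hff := isFF_transport hn hr hX κ u
  funext x z a b
  rcases a with α | μ <;> rcases b with β | ν
  · exact transport_inl_inl hn hr X κ u x z α β
  · exact hff.2 x z (Sum.inl α) ν
  · exact hff.1 x z μ (Sum.inl β)
  · exact hff.1 x z μ (Sum.inr ν)

/-- NOT IN PRINT; OUR BOOKKEEPING ([folklore]).  **A TABLE WHOSE THREE LEG-DIVERGENCE FIELDS VANISH IS FIXED BY `𝒯`** (ff-valued `X`): if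
(slot leg) `∀ x, Σ_κ (X κ (x−e_κ) − X κ x) = 0`, (left kernel leg) `∀ κ u z β x₀, Σ_α (X κ u (x₀−e_α) z (inl α) (inl β) − X κ u x₀ z (inl α) (inl β)) = 0` and (right kernel leg) the
same in `(β, z)`, then `Ψ̂ᵀ ∘ slotPsiS r n X κ u ∘ Ψ̂ = X κ u` (leaf-03's `slotPsiS_eq_self_of_div_eq_zero`, thrice).  In general each leg contributes
`faceWt • (block sum of that leg's divergences)` (`slotPsiS_of_divLaw`) — the tower's slot Ward letters and kernel-LEG Ward letters, block-summed. -/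
theorem transport_eq_self_of_legDiv_zero {X : Fin (d + 1) → Site (d + 1) → MKer (d + 1) (Fib d)} (hX : ∀ κ u, IsFF (X κ u))
    (hslot : ∀ x : Site (d + 1), ∑ κ : Fin (d + 1), (X κ (x - unitVec κ) - X κ x) = 0)
    (hleft : ∀ (κ : Fin (d + 1)) (u z : Site (d + 1)) (β : Fin (d + 1)) (x₀ : Site (d + 1)),
      ∑ α : Fin (d + 1), (X κ u (x₀ - unitVec α) z (Sum.inl α) (Sum.inl β) - X κ u x₀ z (Sum.inl α) (Sum.inl β)) = 0)
    (hright : ∀ (κ : Fin (d + 1)) (u x : Site (d + 1)) (α : Fin (d + 1)) (z₀ : Site (d + 1)),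
      ∑ β : Fin (d + 1), (X κ u x (z₀ - unitVec β) (Sum.inl α) (Sum.inl β) - X κ u x z₀ (Sum.inl α) (Sum.inl β)) = 0)
    (κ : Fin (d + 1)) (u : Site (d + 1)) :
    comp (comp (trK (psiKS r n)) (slotPsiS r n X κ u)) (psiKS r n) = X κ u := by
  have hS : slotPsiS r n X = X := slotPsiS_eq_self_of_div_eq_zero hn r hslot
  rw [transport_eq_threeLegs_of_isFF hn hr hX κ u]
  funext x z a b
  rcases a with α | μ <;> rcases b with β | ν
  · show slotPsiS r n (fun β z => slotPsiS r n (fun α x => slotPsiS r n X κ u x z (Sum.inl α) (Sum.inl β)) α x) β z = X κ u x z (Sum.inl α) (Sum.inl β)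
    rw [hS]
    have hL : ∀ (z : Site (d + 1)) (β : Fin (d + 1)), slotPsiS r n (fun α x => X κ u x z (Sum.inl α) (Sum.inl β)) = fun α x => X κ u x z (Sum.inl α) (Sum.inl β) :=
      fun z β => slotPsiS_eq_self_of_div_eq_zero hn r (fun x₀ => hleft κ u z β x₀)
    simp_rw [hL]
    have hR : slotPsiS r n (fun β z => X κ u x z (Sum.inl α) (Sum.inl β)) = fun β z => X κ u x z (Sum.inl α) (Sum.inl β) :=
      slotPsiS_eq_self_of_div_eq_zero hn r (fun z₀ => hright κ u x α z₀)
    rw [hR]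
  · exact ((hX κ u).2 x z (Sum.inl α) ν).symm
  · exact ((hX κ u).1 x z μ (Sum.inl β)).symm
  · exact ((hX κ u).1 x z μ (Sum.inr ν)).symm

end Summit.QuantumFields.BalabanUV.Beta.GAN24.CombTransportThreeLegs

end
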